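import Summits.Ventures.AbcSig.Rows.XTemplateC2a
import Summits.Ventures.AbcSig.Levels.N346
import Summits.Ventures.AbcSig.Levels.N1384
import Summits.Ventures.AbcSig.Levels.N346M6X

/-!
# Venture AbcSig — ROW `C2aL173A45`: `xⁿ + 2^a·173^m·yⁿ = z²`, class `a 45` (GENERATED by plean/leanrow.py)

HONEST FRAMING. A row of a COMPUTATION cell (`pub-abcsig`); a CONDITIONAL theorem, no claim on ABC or any summit.
Hypotheses: `BS04Package` (CITED), `DataComplete` at levels [346, 1384] (COMPUTED, two-engine certified
level files), `EisPackage` (CITED: [BS04 (3.1), L4.2, Cor 3.1] + [Sturm 1987]) and `Refines` (COMPUTED) for the orbits whose residual exponent is discharged IN THE KERNEL by a module-M6 certificate (`Levels/N…M6X.lean`), and the listed per-orbit exclusions `hX_…` (CITED; the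
row's R5 cell names each) that remain. Everything else is kernel-checked (`Rows/XTemplateC2a.lean`, `Levels/N….lean`). Exponent
range: prime `n ≥ 11`, `n ≠ 173`; `B = 2^a 173^m` with `a, m < n` (n-th-power free).
Row of record:  (sha256 ; SIGNED 2026-08-22T11:24:28Z by referee (ref-g7)); its R0: THEOREM (uses CITED arithmetic facts) for all primes n >= 11 with n coprime to 2768 — class: candidate (a in {4,5} cell; lit/COVERAGE §C2 + IK06 Thm 1.1 applica. Exponents left open by the row of record are excluded here via ; kernel-sieve residuals the row of record closes by a cell module (M6 Eisenstein / M4 Kraus certificates) appear as CITED hypotheses .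
-/

namespace Summit.Ventures.AbcSig

/-- Row `C2aL173A45` (see module docstring). -/
theorem xrow_C2aL173A45 (M : NewformModel) (hP : M.BS04Package) (hE : M.EisPackage)
    (hD346 : M.DataComplete 346 level346Orbits) (hD1384 : M.DataComplete 1384 level1384Orbits)
    (hR_orbit_346_5 : M.Refines 346 orbit_346_5 m6X_346_5)
    (n : ℕ) (hn : n.Prime) (hmin : 11 ≤ n) (hnℓ : n ≠ 173) (a m : ℕ) (ha : a = 4 ∨ a = 5) (hm : 1 ≤ m) (han : a < n) (hmn : m < n)
    (hX_orbit_1384_3 : n ∈ ([13] : List ℕ) → M.Excludes 1384 orbit_1384_3 (famB (2 ^ a * 173 ^ m) n (fun _ _ => True)))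
    (hX_orbit_1384_4 : n ∈ ([11] : List ℕ) → M.Excludes 1384 orbit_1384_4 (famB (2 ^ a * 173 ^ m) n (fun _ _ => True)))
    (x y z : ℤ) (hxy1 : x * y ≠ 1) (hxy2 : x * y ≠ -1) : ¬ IsPrimitiveSolution 1 (2 ^ a * 173 ^ m) 1 n x y z := by
  have hℓ : Nat.Prime 173 := by norm_num
  have h7 : 7 ≤ n := by omega
  have hS346 :=
    (level346_sieve n hn h7 (fun o => M.Excludes 346 o (famB (2 ^ a * 173 ^ m) n (fun _ _ => True)) ∨ M.ExcludesStd 346 o n) (fun hmem => by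
      obtain rfl : n = 7 := by simpa using hmem
      omega) (fun hmem => by
      rcases (by simpa using hmem : n = 7 ∨ n = 29) with rfl | rfl
      · omega
      · exact Or.inr (m6c_346_5_n29_excludes M hE hR_orbit_346_5)))
  have hS1384 :=
    (level1384_sieve n hn h7 (fun o => M.Excludes 1384 o (famB (2 ^ a * 173 ^ m) n (fun _ _ => True)) ∨ M.ExcludesStd 1384 o n) (fun hmem => by
      obtain rfl : n = 7 := by simpa using hmem
      omega) (fun hmem => by
      obtain rfl : n = 7 := by simpa using hmem
      omega) (fun hmem => by
      obtain rfl : n = 13 := by simpa using hmem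
      exact Or.inl (hX_orbit_1384_3 (by simp))) (fun hmem => by
      obtain rfl : n = 11 := by simpa using hmem
      exact Or.inl (hX_orbit_1384_4 (by simp))))
  exact xrowC2a_a45 173 hℓ (by norm_num) M hP n hn h7 hnℓ hD1384 hD346 a m ha hm han hmn
    hS1384
    hS346 x y z hxy1 hxy2

end Summit.Ventures.AbcSig
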